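import Summits.NavierStokesRegularity.FluidComputer.PalasekTowerRegisterGlobalHeredity

/-!
# REGISTER v2.3′: a refutation of heredity witnesses a rung (the Negative lane pays the base first)

Cell `ns-blowup`, planner seat `ns-blowup-plan` (g18) TURNKEY for an E–C typing seat (bears_on LADDER-NS
N1, route `PalasekTowerBreakdown`, items 19249 `HeredityAtOne`, 19250 `HeredityFromTwo`, 19178
`EpisodeInduction`, 19179 `EpisodeBase`; answers tribunal T2's ∀-form supplement
`t2-r3-forall-cap-supplement.md` 3eec0c4d45769a4d). LABEL: E–C typing (KERNEL plumbing by classical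
logic; theorems only, no definition, no named fact). WHAT THIS IS NOT: not Navier–Stokes evidence —
nothing is constructed, asserted or refuted.

The ∀-form heredity binders quantify over EVERY pinned, rigid, quiet wide schedule and EVERY globally
anchored registered stage. Their negations are therefore EXISTENTIAL: a counterexample to heredity at
level `k` consists of a schedule and a registered stage at level `k` (that fails to hand over) — which is
by itself a witness of the rung `RungG k`. Consequences typed here:

* `rungG_of_not_heredityAt` — `¬ HeredityAt k → RungG k`;
* `episodeBaseG_of_not_heredityAtOne` — `¬ HeredityAtOne → EpisodeBaseG` (a refutation of the route's
  first prover target 19249 CLOSES the base item 19179 = `RungG 1`); `heredityAtOne_or_episodeBaseG`;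
* `exists_rungG_of_not_heredityFrom` — `¬ HeredityFrom k₀ → ∃ k ≥ k₀, RungG k`;
  `exists_rungG_of_not_episodeInductionG` — `¬ EpisodeInductionG → ∃ k ≥ 1, RungG k`.

Reading (planner, record only): the Negative lane against any heredity binder must first SOLVE a base
problem (register a stage at the level it attacks) — in a «sterile» sub-class (e.g. axisymmetric without
swirl, where a printed all-time speed cap applies) that base problem is the open construction T2 names;
in a fertile class it is item 19179 itself.

References: S. Palasek, arXiv:2605.13827 §4 [cite: Palasek2026ElementaryModel, §4].
-/

noncomputable section

namespace Summit.NavierStokesRegularity.FluidComputer.PalasekTowerClayBridge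

/-- **A refutation of heredity at level `k` witnesses rung `k`**: the counterexample's schedule and
registered level-`k` stage inhabit `RungG k`. [folklore] -/
theorem rungG_of_not_heredityAt {k : ℕ} (h : ¬ HeredityAt k) : RungG k := by
  by_contra hk
  exact h fun S hP hR hQ s => absurd (⟨S, hP, hR, hQ, ⟨s⟩⟩ : RungG k) hk

/-- **A refutation of the first rung of the crux closes the base item**: `¬ HeredityAtOne → EpisodeBaseG`
(item 19249's negation proves item 19179). [folklore] -/
theorem episodeBaseG_of_not_heredityAtOne (h : ¬ HeredityAtOne) : EpisodeBaseG :=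
  rungG_one_iff.1 (rungG_of_not_heredityAt (k := 1) (fun h1 => h (heredityAtOne_iff.2 h1)))

/-- The dichotomy of record: the first hand-over holds vacuously-or-not, or the base item holds.
[folklore] -/
theorem heredityAtOne_or_episodeBaseG : HeredityAtOne ∨ EpisodeBaseG :=
  (em HeredityAtOne).imp_right episodeBaseG_of_not_heredityAtOne

/-- **A refutation of heredity from `k₀` witnesses some rung `k ≥ k₀`.** [folklore] -/
theorem exists_rungG_of_not_heredityFrom {k₀ : ℕ} (h : ¬ HeredityFrom k₀) :
    ∃ k, k₀ ≤ k ∧ RungG k := by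
  by_contra hk
  push Not at hk
  exact h fun S hP hR hQ k hk₀ s => absurd (⟨S, hP, hR, hQ, ⟨s⟩⟩ : RungG k) (hk k hk₀)

/-- **A refutation of K2G witnesses some rung `k ≥ 1`.** [folklore] -/
theorem exists_rungG_of_not_episodeInductionG (h : ¬ EpisodeInductionG) : ∃ k, 1 ≤ k ∧ RungG k :=
  exists_rungG_of_not_heredityFrom (k₀ := 1) fun h1 => h (episodeInductionG_iff_heredityFrom_one.2 h1)

end Summit.NavierStokesRegularity.FluidComputer.PalasekTowerClayBridge
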